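import Summits.HodgeConjecture.HodgeConjecture.Theorems.NikulinTwinTransportLefschetzOneOneK3Local
import Summits.HodgeConjecture.HodgeConjecture.Theorems.NikulinTwinTransportLefschetzOneOneK3Exact
import Summits.HodgeConjecture.HodgeConjecture.Theorems.NikulinTwinTransportLefschetzOneOneK3
import Literature.AlgebraicGeometry.HodgeTheory.HypersurfaceHolomorphicForms

/-!
# Route NikulinTwinTransport — `LefschetzOneOneK3` (item stmt-HodgeConjecture-13678): the `∂∂̄`–exponential line

**The complex-analytic heart of Lefschetz's theorem on `(1,1)`-classes (Voisin I, Thm. 11.30), proved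
on the real carriers by the explicit Čech construction of Weil / Kodaira on a chart-convex cover of a
Hodge model.** For a Hodge model `A` of a smooth projective `X/ℂ` (carrier `M`, compact complex
manifold, model space `E`, natural de Rham comparison `e = A.deRham`) and a finite chart-convex
cover `𝒰` of `M` (`exists_chartConvexCover`), an integral class `β ∈ H²(M; ℂ)` lying in
`A.hodgePQ 2 1 1 = e(H^{1,1})` restricts to `0` off a proper closed analytic subset of `M`
(`integral_vanishing_of_cechRationalBridge_at`), GIVEN two inputs at `A`:

* **(B) the Čech-rational bridge for `e` on `𝒰`** — for some `r ≠ 0` and every closed smooth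
  `2`-form `α` with potentials `η_i` (`dη_i = α` on `U_i`) and `f_ij` (`df_ij = η_i - η_j` on
  `U_i ∩ U_j`): if `e[α]` is a rational class then the Čech `2`-cocycle `r·(f_ij + f_jk - f_ik)` is,
  up to a coboundary of constants, a constant rational number on each `U_i ∩ U_j ∩ U_k`. This is
  de Rham's theorem in Weil's Čech form with its `ℚ`-structure (Bott–Tu Thm. 8.9 / 15.8) for the
  natural family `e` — true for every natural family by the rigidity of natural comparisons
  (`NaturalDeRhamComparisonRigidity_holds`); it is the ONLY topological input and is not in the
  tree in proved form;
* **(T) Kodaira–Serre triviality** — every holomorphic line bundle on `M` presented by a cocycle is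
  trivial off a proper closed analytic subset (Voisin I, proof of Cor. 11.34; GAGA).

Construction (all steps proved here and in the companion files `…Holomorphy`, `…Calculus`,
`…Local`, `…Exact`): `β = e[α]` with `α` closed of type `(1,1)` (`exists_closed_oneOne_rep_of_mem_hodgePQ`);
`α = ∂∂̄ψ_i` on each `U_i` (local `∂∂̄`-lemma `exists_ddbar_potential`); `ψ_i - ψ_j = G_ij + K_ij`
with `G_ij` holomorphic, `K_ij` antiholomorphic (`hol_add_antihol_of_ddbar_eq_zero`), so that
`∂ψ_i - ∂ψ_j = dG_ij`; the bridge applied to `η_i = -∂ψ_i`, `f_ij = -G_ij` makes, after clearing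
denominators `N` and rescaling by `c₀ = -N r`, the cocycle `G'_ij = c₀ G_ij + N b_ij` integral on
triple overlaps, whence the HOLOMORPHIC LINE BUNDLE `g_ij = exp(2πi G'_ij)`; (T) trivialises it off
a proper analytic `T`, and then `c₀ α = ∂∂̄(c₀ψ_i)` is exact on `M ∖ T`
(`map_mk_eq_zero_of_isTrivialOn`: glue `-∂(c₀ψ_i) - (2πi)⁻¹ s_i⁻¹ds_i`); naturality of `e` along
`M ∖ T ↪ M` gives `c₀ β|_{M∖T} = 0`. With seat 3's `lefschetzOneOneK3_of_integral_vanishing`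
(Chow + universal coefficients + the support filtration) this proves the route item from (B) + (T):
`lefschetzOneOneK3_of_cechRationalBridge_of_isTrivialOn`.
-/

noncomputable section

open scoped Manifold ContDiff Topology
open Set Filter
open Literature.AlgebraicTopology.SingularHomology (singularCohomology)
open Literature.AlgebraicGeometry
open Literature.AlgebraicGeometry.HodgeTheory
open Literature.Geometry.Kaehler
open Literature.NumberTheory.Transcendental

namespace Summit.HodgeConjecture.HodgeConjecture.Theorems

open Summit.HodgeConjecture.HodgeConjecture.Theses.NikulinTwinTransport

/-! ### A class in `H^{1,1}` is represented by one closed `(1,1)`-form -/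

section Rep

variable {E : Type} [NormedAddCommGroup E] [NormedSpace ℂ E]
  {M : Type} [TopologicalSpace M] [ChartedSpace E M]

/-- **A class in `H^{1,1} ⊆ H²_dR(M; ℂ)` is the class of ONE closed smooth `(1,1)`-form**: the
closed forms of type `(1,1)` form a `ℂ`-submodule, so the span of their classes is the image of that
submodule. [cite: VoisinHodgeI2002, §6.1] -/
theorem exists_closed_oneOne_rep_of_mem_hodgePQ {w : complexDeRhamCohomology E M 2} (hw : w ∈ hodgePQ E M 2 1 1) :
    ∃ (α : MForm 𝓘(ℝ, E) M ℂ 2) (hs : IsSmoothForm α) (hc : IsClosedForm α),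
      IsOfType 1 1 α ∧ w = complexDeRhamCohomology.mk E M 2 ⟨α, mem_cclosedSmoothForms hs hc⟩ := by
  let T : Submodule ℂ (cclosedSmoothForms E M 2) :=
    { carrier := {α | IsOfType 1 1 (α : MForm 𝓘(ℝ, E) M ℂ 2)}
      add_mem' := fun ha hb ↦ ha.add hb
      zero_mem' := isOfType_zero rfl
      smul_mem' := fun c _ ha ↦ ha.smul c }
  have hle : hodgePQ E M 2 1 1 ≤ T.map (complexDeRhamCohomology.mk E M 2) := by
    refine Submodule.span_le.2 ?_
    rintro _ ⟨α, hα, rfl⟩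
    exact ⟨α, hα, rfl⟩
  obtain ⟨α, hαT, rfl⟩ := hle hw
  obtain ⟨hs, hc⟩ := (mem_cclosedSmoothForms_iff (α : MForm 𝓘(ℝ, E) M ℂ 2)).1 α.2
  exact ⟨α, hs, hc, hαT, rfl⟩

end Rep

/-! ### Small algebra of `0`-forms -/

section OfFun

variable {E : Type} [NormedAddCommGroup E] [NormedSpace ℂ E] [FiniteDimensional ℂ E]
  {M : Type} [TopologicalSpace M] [ChartedSpace E M] [IsManifold 𝓘(ℂ, E) ω M]
  [IsManifold 𝓘(ℝ, E) ∞ M]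

omit [FiniteDimensional ℂ E] [IsManifold 𝓘(ℂ, E) ω M] [IsManifold 𝓘(ℝ, E) ∞ M] in
/-- `ofFun` of a pointwise negation. [folklore] -/
theorem ofFun_neg_fun (f : M → ℂ) :
    (MForm.ofFun 𝓘(ℝ, E) fun y ↦ -f y) = -MForm.ofFun 𝓘(ℝ, E) f := by
  funext x; ext v; rfl

omit [FiniteDimensional ℂ E] [IsManifold 𝓘(ℂ, E) ω M] [IsManifold 𝓘(ℝ, E) ∞ M] in
/-- `ofFun` of a sum with a constant. [folklore] -/
theorem ofFun_add_const_fun (f : M → ℂ) (d : ℂ) :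
    (MForm.ofFun 𝓘(ℝ, E) fun y ↦ f y + d) =
      MForm.ofFun 𝓘(ℝ, E) f + MForm.ofFun 𝓘(ℝ, E) fun _ ↦ d := by
  funext x; ext v; rfl

omit [FiniteDimensional ℂ E] [IsManifold 𝓘(ℂ, E) ω M] [IsManifold 𝓘(ℝ, E) ∞ M] in
/-- Holomorphy of `c * G + d`. [folklore] -/
theorem hol_affine {V : Set M} {G : M → ℂ} (c d : ℂ) (hG : MDifferentiableOn 𝓘(ℂ, E) 𝓘(ℂ, ℂ) G V) :
    MDifferentiableOn 𝓘(ℂ, E) 𝓘(ℂ, ℂ) (fun y ↦ c * G y + d) V :=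
  (mdifferentiableOn_const.mul hG).add mdifferentiableOn_const

omit [FiniteDimensional ℂ E] [IsManifold 𝓘(ℂ, E) ω M] [IsManifold 𝓘(ℝ, E) ∞ M] in
/-- `d(c * G + d) = c • dG` at a point where `G` is smooth. [folklore] -/
theorem mextDeriv_ofFun_affine {G : M → ℂ} (c d : ℂ) {x : M}
    (hG : (MForm.ofFun 𝓘(ℝ, E) G).SmoothAt x) :
    mextDeriv (MForm.ofFun 𝓘(ℝ, E) fun y ↦ c * G y + d) x =
      c • mextDeriv (MForm.ofFun 𝓘(ℝ, E) G) x := by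
  rw [ofFun_add_const_fun, ofFun_const_mul, mextDeriv_add_apply (smoothAt_smul_complex c hG)
    (MForm.smoothAt_ofFun_of_contMDiffAt contMDiffAt_const), mextDeriv_smul_complex_holds,
    mextDeriv_ofFun_const]
  simp

end OfFun

/-! ### Finite intersections of one and two members of a cover -/

section Cech

variable {M : Type} {ι : Type} (U : ι → Set M)

/-- `U_(i) = U_i`. [folklore] -/
theorem cechSet_fin_one (i : ι) : Literature.Geometry.Kaehler.cechSet U (fun _ : Fin 1 ↦ i) = U i := by
  ext x; simp [Literature.Geometry.Kaehler.mem_cechSet_iff]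

/-- `U_(i,j) = U_i ∩ U_j`. [folklore] -/
theorem cechSet_fin_two (i j : ι) : Literature.Geometry.Kaehler.cechSet U ![i, j] = U i ∩ U j := by
  ext x; simp [Literature.Geometry.Kaehler.mem_cechSet_iff, Fin.forall_fin_two]

end Cech

/-! ### The assembly -/

section Assembly

variable {n : ℕ} {S : Motives.SchemeOver ℂ}

/-- **The integral vanishing statement at one Hodge model, from the Čech-rational bridge and the
triviality of cocycle line bundles off proper analytic subsets.** -/
theorem integral_vanishing_of_cechRationalBridge_at (A : HodgeModel n S) {ι : Type} [Fintype ι] (𝒰 : ChartConvexCover A.model A.carrier ι)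
    (hB : ∃ r : ℂ, r ≠ 0 ∧
      ∀ (α : MForm 𝓘(ℝ, A.model) A.carrier ℂ 2) (hs : IsSmoothForm α) (hc : IsClosedForm α)
        (η : ι → MForm 𝓘(ℝ, A.model) A.carrier ℂ 1)
        (_ : ∀ i, ∀ x ∈ 𝒰.U i, (η i).SmoothAt x ∧ mextDeriv (η i) x = α x)
        (f : ι → ι → A.carrier → ℂ)
        (_ : ∀ i j, ∀ x ∈ 𝒰.U i ∩ 𝒰.U j,
          (MForm.ofFun 𝓘(ℝ, A.model) (f i j)).SmoothAt x ∧
            mextDeriv (MForm.ofFun 𝓘(ℝ, A.model) (f i j)) x = η i x - η j x),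
        IsRationalClass (A.deRham A.carrier 2
          (complexDeRhamCohomology.mk A.model A.carrier 2 ⟨α, mem_cclosedSmoothForms hs hc⟩)) →
        ∃ (b : ι → ι → ℂ) (q : ι → ι → ι → ℚ), ∀ i j k, ∀ x ∈ 𝒰.U i ∩ 𝒰.U j ∩ 𝒰.U k,
          r * (f i j x + f j k x - f i k x) + (b i j + b j k - b i k) = (q i j k : ℂ))
    (hT : ∀ L : HolomorphicLineBundle ι A.model A.carrier,
      ∃ T : Set A.carrier, IsAnalyticSet 𝓘(ℂ, A.model) T ∧ T ≠ Set.univ ∧ L.IsTrivialOn Tᶜ)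
    (β : singularCohomology ℂ ℂ A.carrier (2 * 1)) (hβi : IsIntegralClass β)
    (hβ11 : β ∈ A.hodgePQ (2 * 1) 1 1) :
    ∃ T : Set A.carrier, IsAnalyticSet 𝓘(ℂ, A.model) T ∧ T ≠ Set.univ ∧
      singularCohomology.map ℂ ℂ
        (⟨Subtype.val, continuous_subtype_val⟩ : C({m : A.carrier // m ∉ T}, A.carrier))
        (2 * 1) β = 0 := by
  -- notation
  set E := A.model with hE
  set M := A.carrier with hM
  have hUo : ∀ i, IsOpen (𝒰.U i) := 𝒰.isOpen
  have hcov : ∀ x : M, ∃ i, x ∈ 𝒰.U i := fun x ↦ by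
    have hx : x ∈ ⋃ i, 𝒰.U i := by rw [𝒰.iUnion_eq]; exact Set.mem_univ x
    simpa only [Set.mem_iUnion] using hx
  -- Step 1: a closed `(1,1)` representative `α` with `β = A.deRham[α]`
  obtain ⟨w, hw, hwβ⟩ := Submodule.mem_map.1 hβ11
  obtain ⟨α, hs, hc, h11, rfl⟩ := exists_closed_oneOne_rep_of_mem_hodgePQ hw
  subst hwβ
  -- Step 2: local `∂∂̄`-potentials on the members of the cover
  have hloc : ∀ i, ∃ ψ : M → ℂ, (∀ x ∈ 𝒰.U i, (MForm.ofFun 𝓘(ℝ, E) ψ).SmoothAt x) ∧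
      ∀ x ∈ 𝒰.U i, dolbeault (dolbeaultBar (MForm.ofFun 𝓘(ℝ, E) ψ)) x = α x := by
    intro i
    rcases (𝒰.U i).eq_empty_or_nonempty with he | hne
    · exact ⟨0, fun x hx ↦ by rw [he] at hx; exact absurd hx (Set.notMem_empty x),
        fun x hx ↦ by rw [he] at hx; exact absurd hx (Set.notMem_empty x)⟩
    · obtain ⟨p, C, hC, hCc, hCt, hJ⟩ := 𝒰.exists_chart 0 (fun _ ↦ i) (by rwa [cechSet_fin_one])
      rw [cechSet_fin_one] at hJ
      obtain ⟨ψ, h1, h2⟩ := exists_ddbar_potential p hC hCc hCt hs hc h11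
      exact ⟨ψ, fun x hx ↦ h1 x (hJ ▸ hx), fun x hx ↦ h2 x (hJ ▸ hx)⟩
  choose ψ hψs hψα using hloc
  -- Step 3: holomorphic + antiholomorphic splitting of `ψ_i - ψ_j` on `U_i ∩ U_j`
  have hsplit : ∀ i j, ∃ G K : M → ℂ,
      MDifferentiableOn 𝓘(ℂ, E) 𝓘(ℂ, ℂ) G (𝒰.U i ∩ 𝒰.U j) ∧
      MDifferentiableOn 𝓘(ℂ, E) 𝓘(ℂ, ℂ) (fun x ↦ (starRingEnd ℂ) (K x)) (𝒰.U i ∩ 𝒰.U j) ∧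
      ∀ x ∈ 𝒰.U i ∩ 𝒰.U j, ψ i x - ψ j x = G x + K x := by
    intro i j
    rcases (𝒰.U i ∩ 𝒰.U j).eq_empty_or_nonempty with he | hne
    · refine ⟨0, 0, ?_, ?_, fun x hx ↦ by rw [he] at hx; exact absurd hx (Set.notMem_empty x)⟩
      · rw [he]; exact fun y hy ↦ absurd hy (Set.notMem_empty y)
      · rw [he]; exact fun y hy ↦ absurd hy (Set.notMem_empty y)
    · obtain ⟨p, C, hC, hCc, hCt, hJ⟩ := 𝒰.exists_chart 1 ![i, j] (by rwa [cechSet_fin_two])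
      rw [cechSet_fin_two] at hJ
      have hVo : IsOpen (𝒰.U i ∩ 𝒰.U j) := (hUo i).inter (hUo j)
      have hχ : ∀ x ∈ 𝒰.U i ∩ 𝒰.U j, (MForm.ofFun 𝓘(ℝ, E) fun y ↦ ψ i y - ψ j y).SmoothAt x :=
        fun x hx ↦ (dolbeault_ofFun_sub hVo (fun y hy ↦ hψs i y hy.1)
          (fun y hy ↦ hψs j y hy.2) hx).1
      have h0 : ∀ x ∈ 𝒰.U i ∩ 𝒰.U j,
          dolbeault (dolbeaultBar (MForm.ofFun 𝓘(ℝ, E) fun y ↦ ψ i y - ψ j y)) x = 0 := by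
        intro x hx
        rw [(dolbeault_ofFun_sub hVo (fun y hy ↦ hψs i y hy.1) (fun y hy ↦ hψs j y hy.2)
          hx).2.2, hψα i x hx.1, hψα j x hx.2, sub_self]
      obtain ⟨G, K, hG, hK, hGK⟩ := hol_add_antihol_of_ddbar_eq_zero p hC hCc hCt
        (fun x hx ↦ hχ x (hJ ▸ hx)) (fun x hx ↦ h0 x (hJ ▸ hx))
      refine ⟨G, K, hJ ▸ hG, hJ ▸ hK, fun x hx ↦ hGK x (hJ ▸ hx)⟩
  choose G K hG hK hGK using hsplit
  -- Step 4: the Čech data fed to the bridge: `η_i = -∂ψ_i`, `f_ij = -G_ij`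
  obtain ⟨r, hr, hBr⟩ := hB
  have hdiff : ∀ i j, ∀ x ∈ 𝒰.U i ∩ 𝒰.U j,
      dolbeault (MForm.ofFun 𝓘(ℝ, E) (ψ i)) x - dolbeault (MForm.ofFun 𝓘(ℝ, E) (ψ j)) x =
        mextDeriv (MForm.ofFun 𝓘(ℝ, E) (G i j)) x := by
    intro i j x hx
    have hVo : IsOpen (𝒰.U i ∩ 𝒰.U j) := (hUo i).inter (hUo j)
    rw [← (dolbeault_ofFun_sub hVo (fun y hy ↦ hψs i y hy.1) (fun y hy ↦ hψs j y hy.2)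
      hx).2.1]
    exact dolbeault_ofFun_eq_mextDeriv_of_hol_add_antihol hVo (hG i j) (hK i j) (hGK i j) hx
  obtain ⟨b, q, hbq⟩ := hBr α hs hc (fun i ↦ -dolbeault (MForm.ofFun 𝓘(ℝ, E) (ψ i)))
    (fun i x hx ↦ by
      obtain ⟨h1, h2⟩ := mextDeriv_dolbeault_ofFun (hUo i) (hψs i) hx
      refine ⟨h1.neg, ?_⟩
      rw [mextDeriv_neg, Pi.neg_apply, h2, neg_neg, hψα i x hx])
    (fun i j x ↦ -G i j x)
    (fun i j x hx ↦ by
      have hVo : IsOpen (𝒰.U i ∩ 𝒰.U j) := (hUo i).inter (hUo j)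
      have hsm := smoothAt_ofFun_of_hol hVo (hG i j) hx
      refine ⟨by rw [ofFun_neg_fun]; exact hsm.neg, ?_⟩
      rw [ofFun_neg_fun, mextDeriv_neg, Pi.neg_apply, ← hdiff i j x hx, Pi.neg_apply, Pi.neg_apply]
      abel)
    hβi.isRationalClass
  -- Step 5: clear denominators
  classical
  set N : ℕ := ∏ t : ι × ι × ι, (q t.1 t.2.1 t.2.2).den with hN
  have hNpos : 0 < N := Finset.prod_pos fun t _ ↦ (q t.1 t.2.1 t.2.2).den_pos
  have hNq : ∀ i j k, ∃ m : ℤ, (N : ℂ) * (q i j k : ℂ) = (m : ℂ) := by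
    intro i j k
    obtain ⟨c, hc⟩ : (q i j k).den ∣ N :=
      Finset.dvd_prod_of_mem (fun t : ι × ι × ι ↦ (q t.1 t.2.1 t.2.2).den)
        (Finset.mem_univ (i, j, k))
    refine ⟨c * (q i j k).num, ?_⟩
    have h1 : ((q i j k) * (q i j k).den : ℚ) = (q i j k).num := Rat.mul_den_eq_num _
    have h2 : ((N : ℚ) * q i j k : ℚ) = (c * (q i j k).num : ℤ) := by
      rw [hc]; push_cast; rw [← h1]; ring
    exact_mod_cast congrArg (fun t : ℚ ↦ (t : ℂ)) h2
  -- Step 6: rescale: `c₀ = -(N r)`, `ψ' = c₀ ψ`, `G' = c₀ G + N b`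
  set c₀ : ℂ := -((N : ℂ) * r) with hc₀
  have hc₀ne : c₀ ≠ 0 := neg_ne_zero.2 (mul_ne_zero (by exact_mod_cast hNpos.ne') hr)
  set ψ' : ι → M → ℂ := fun i y ↦ c₀ * ψ i y with hψ'
  set G' : ι → ι → M → ℂ := fun i j y ↦ c₀ * G i j y + N * b i j with hG'_def
  set α' : MForm 𝓘(ℝ, E) M ℂ 2 := c₀ • α with hα'
  have hs' : IsSmoothForm α' := hs.smul_complex c₀
  have hc' : IsClosedForm α' := by
    change mextDeriv (c₀ • α) = 0
    rw [mextDeriv_smul_complex_holds, hc, smul_zero]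
  have hψ's : ∀ i, ∀ x ∈ 𝒰.U i, (MForm.ofFun 𝓘(ℝ, E) (ψ' i)).SmoothAt x :=
    fun i x hx ↦ (dolbeault_ofFun_const_mul c₀ (hψs i) hx).1
  have hψ'α : ∀ i, ∀ x ∈ 𝒰.U i,
      dolbeault (dolbeaultBar (MForm.ofFun 𝓘(ℝ, E) (ψ' i))) x = α' x := by
    intro i x hx
    rw [(dolbeault_ofFun_const_mul c₀ (hψs i) hx).2.2, hψα i x hx]
    rfl
  have hG' : ∀ i j, MDifferentiableOn 𝓘(ℂ, E) 𝓘(ℂ, ℂ) (G' i j) (𝒰.U i ∩ 𝒰.U j) :=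
    fun i j ↦ hol_affine c₀ (N * b i j) (hG i j)
  have hψ'G : ∀ i j, ∀ x ∈ 𝒰.U i ∩ 𝒰.U j,
      dolbeault (MForm.ofFun 𝓘(ℝ, E) (ψ' i)) x - dolbeault (MForm.ofFun 𝓘(ℝ, E) (ψ' j)) x =
        mextDeriv (MForm.ofFun 𝓘(ℝ, E) (G' i j)) x := by
    intro i j x hx
    have hVo : IsOpen (𝒰.U i ∩ 𝒰.U j) := (hUo i).inter (hUo j)
    rw [(dolbeault_ofFun_const_mul c₀ (hψs i) hx.1).2.1,
      (dolbeault_ofFun_const_mul c₀ (hψs j) hx.2).2.1, ← smul_sub, hdiff i j x hx,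
      mextDeriv_ofFun_affine c₀ (N * b i j) (smoothAt_ofFun_of_hol hVo (hG i j) hx)]
  -- Step 7: integrality of the rescaled cocycle
  have hint : ∀ i j k, ∀ x ∈ 𝒰.U i ∩ 𝒰.U j ∩ 𝒰.U k,
      ∃ m : ℤ, G' i j x + G' j k x - G' i k x = m := by
    intro i j k x hx
    obtain ⟨m, hm⟩ := hNq i j k
    refine ⟨m, ?_⟩
    have h := hbq i j k x hx
    have : G' i j x + G' j k x - G' i k x =
        (N : ℂ) * (r * (-G i j x + -G j k x - -G i k x) + (b i j + b j k - b i k)) := by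
      simp only [hG'_def, hc₀]; ring
    rw [this, h, hm]
  -- Step 8: the holomorphic line bundle with transition functions `exp(2πi G'_ij)`
  let L : HolomorphicLineBundle ι E M :=
    { baseSet := 𝒰.U
      isOpen_baseSet := hUo
      exists_mem_baseSet := hcov
      coordChange := fun i j y ↦ Complex.exp (2 * Real.pi * Complex.I * G' i j y)
      mdifferentiableOn_coordChange := fun i j y hy ↦
        Complex.differentiable_exp.comp_mdifferentiableWithinAt
          ((mdifferentiableOn_const.mul (hG' i j)) y hy)
      coordChange_ne_zero := fun i j y _ ↦ Complex.exp_ne_zero _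
      coordChange_comp := fun i j k y hy ↦ by
        obtain ⟨m, hm⟩ := hint i j k y hy
        rw [← Complex.exp_add]
        have : 2 * Real.pi * Complex.I * G' i j y + 2 * Real.pi * Complex.I * G' j k y =
            2 * Real.pi * Complex.I * G' i k y + m * (2 * Real.pi * Complex.I) := by
          have h' : G' i j y + G' j k y = G' i k y + m := by rw [← hm]; ring
          calc _ = 2 * Real.pi * Complex.I * (G' i j y + G' j k y) := by ring
            _ = _ := by rw [h']; ring
        rw [this, Complex.exp_add, Complex.exp_int_mul_two_pi_mul_I, mul_one] }
  -- Step 9: Kodaira–Serre: `L` is trivial off a proper analytic subset `T`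
  obtain ⟨T, hTa, hTne, s, hs₁, hs₂, hs₃⟩ := hT L
  refine ⟨T, hTa, hTne, ?_⟩
  let W : TopologicalSpace.Opens M := ⟨Tᶜ, hTa.isClosed.isOpen_compl⟩
  -- Step 10: `α'` is exact on `W`
  have hex : complexDeRhamCohomology.map E (contMDiff_real_subtype_val (U := W)) 2
      (complexDeRhamCohomology.mk E M 2 ⟨α', mem_cclosedSmoothForms hs' hc'⟩) = 0 :=
    map_mk_eq_zero_of_isTrivialOn 𝒰.U hUo hcov ψ' hψ's G' hG' hψ'G hs' hc' hψ'α W s hs₁ hs₂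
      (fun i j x hx ↦ hs₃ i j x hx)
  -- Step 11: naturality of the model's comparison along `W ↪ M`
  haveI : SigmaCompactSpace W := A.sigmaCompactSpace_opens W
  have hnat := A.deRham_isNatural W M Subtype.val (contMDiff_real_subtype_val (U := W)) 2
    (complexDeRhamCohomology.mk E M 2 ⟨α', mem_cclosedSmoothForms hs' hc'⟩)
  rw [hex, map_zero] at hnat
  have hmk : complexDeRhamCohomology.mk E M 2 ⟨α', mem_cclosedSmoothForms hs' hc'⟩ =
      c₀ • complexDeRhamCohomology.mk E M 2 ⟨α, mem_cclosedSmoothForms hs hc⟩ := by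
    rw [← map_smul]; rfl
  rw [hmk, map_smul, map_smul] at hnat
  have key := hnat.symm
  rw [smul_eq_zero] at key
  exact key.resolve_left hc₀ne

end Assembly

/-! ### The route item from the bridge and the Kodaira–Serre triviality -/

section Item

/-- **`LefschetzOneOneK3` from the Čech-rational bridge and the triviality of cocycle line bundles
off proper analytic subsets, on Hodge models of the surfaces of the item** — the complex-analytic
heart of Voisin I, Thm. 11.30 (local `∂∂̄`-lemma, holomorphic splitting of pluriharmonic functions,
the exponential cocycle, exactness of `∂∂̄ψ` where the cocycle is trivialised) being PROVED on the
real carriers (`integral_vanishing_of_cechRationalBridge_at`). -/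
theorem lefschetzOneOneK3_of_cechRationalBridge_of_isTrivialOn
    (hB : ∀ ⦃S : Motives.SchemeOver ℂ⦄,
      (Motives.IsSmoothProjective 2 S ∧ Subsingleton (Motives.structureSheafCohomology S.left 1) ∧
        ∃ (A : HodgeModel 2 S) (η : MForm 𝓘(ℝ, A.model) A.carrier ℂ 2),
          Literature.Geometry.Kaehler.IsHolomorphicInCharts η ∧ ∀ x, η x ≠ 0) →
      ∀ (A : HodgeModel 2 S) (ι : Type) [Fintype ι] (𝒰 : ChartConvexCover A.model A.carrier ι),
        ∃ r : ℂ, r ≠ 0 ∧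
          ∀ (α : MForm 𝓘(ℝ, A.model) A.carrier ℂ 2) (hs : IsSmoothForm α) (hc : IsClosedForm α)
            (η : ι → MForm 𝓘(ℝ, A.model) A.carrier ℂ 1)
            (_ : ∀ i, ∀ x ∈ 𝒰.U i, (η i).SmoothAt x ∧ mextDeriv (η i) x = α x)
            (f : ι → ι → A.carrier → ℂ)
            (_ : ∀ i j, ∀ x ∈ 𝒰.U i ∩ 𝒰.U j,
              (MForm.ofFun 𝓘(ℝ, A.model) (f i j)).SmoothAt x ∧
                mextDeriv (MForm.ofFun 𝓘(ℝ, A.model) (f i j)) x = η i x - η j x),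
            IsRationalClass (A.deRham A.carrier 2
              (complexDeRhamCohomology.mk A.model A.carrier 2 ⟨α, mem_cclosedSmoothForms hs hc⟩)) →
            ∃ (b : ι → ι → ℂ) (q : ι → ι → ι → ℚ), ∀ i j k, ∀ x ∈ 𝒰.U i ∩ 𝒰.U j ∩ 𝒰.U k,
              r * (f i j x + f j k x - f i k x) + (b i j + b j k - b i k) = (q i j k : ℂ))
    (hT : ∀ ⦃S : Motives.SchemeOver ℂ⦄,
      (Motives.IsSmoothProjective 2 S ∧ Subsingleton (Motives.structureSheafCohomology S.left 1) ∧
        ∃ (A : HodgeModel 2 S) (η : MForm 𝓘(ℝ, A.model) A.carrier ℂ 2),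
          Literature.Geometry.Kaehler.IsHolomorphicInCharts η ∧ ∀ x, η x ≠ 0) →
      ∀ (A : HodgeModel 2 S) (ι : Type) (L : HolomorphicLineBundle ι A.model A.carrier),
        ∃ T : Set A.carrier, IsAnalyticSet 𝓘(ℂ, A.model) T ∧ T ≠ Set.univ ∧ L.IsTrivialOn Tᶜ) :
    LefschetzOneOneK3 := by
  refine lefschetzOneOneK3_of_integral_vanishing fun S hK3 A β hβi hβ11 ↦ ?_
  haveI : CompactSpace A.carrier := A.compactSpace_carrier hK3.1
  obtain ⟨t, ⟨𝒰⟩⟩ := exists_chartConvexCover (E := A.model) (M := A.carrier)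
  exact integral_vanishing_of_cechRationalBridge_at A 𝒰 (hB hK3 A _ 𝒰) (fun L ↦ hT hK3 A _ L)
    β hβi hβ11

end Item

end Summit.HodgeConjecture.HodgeConjecture.Theorems

end
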